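import Mathlib.Analysis.SpecialFunctions.PolarCoord
import Mathlib.Analysis.SpecialFunctions.Trigonometric.Deriv
import Mathlib.Analysis.Complex.RealDeriv
import Mathlib.Analysis.Calculus.FDeriv.Const
import Mathlib.MeasureTheory.Integral.IntegralEqImproper
import Mathlib.MeasureTheory.Integral.Prod
import Mathlib.LinearAlgebra.Complex.FiniteDimensional
import HarnessLib

/-!
# The Cauchy–Pompeiu formula for compactly supported `C¹` functions

For a complex Banach space `F`, a function `φ ∈ C¹_c(ℂ, F)` and every `z ∈ ℂ`,

  `φ z = ∫_ℂ (π t)⁻¹ • (∂φ/∂z̄)(z - t) dA(t)`,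

that is, `φ = K ⋆ ∂̄φ` with the **Cauchy kernel** `K(t) = 1/(π t)`. This is Hörmander's
generalized Cauchy integral formula [Hörmander 1973, Thm. 1.2.1, (1.2.3)] for a disc `ω`
containing `supp φ` (so that the boundary integral vanishes), after the change of variables
`z - t ↦ t` and with `(2πi)⁻¹ dz ∧ dz̄ = -π⁻¹ dA`; equivalently, `∂̄ K = δ₀` in the sense of
distributions. It is the identity behind Hörmander's Theorem 1.2.2 (`u = K ⋆ g` solves
`∂u/∂z̄ = g`), see `Literature/Analysis/Complex/CauchyTransform.lean`.

## Contents

* `Literature.Analysis.Complex.dbarAlong v u x = ½ (Du(x)[v] + i • Du(x)[i v])`: the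
  Cauchy–Riemann operator of `u : E → F` in the direction `v ∈ E` (`E`, `F` complex normed
  spaces, `D = fderiv ℝ`); for `E = ℂ`, `v = 1` it is the Wirtinger derivative
  `∂/∂z̄ = ½ (∂ₓ + i ∂_y)` (`dbarAlong_one`). It vanishes on complex-differentiable functions
  (`dbarAlong_eq_zero_of_differentiableAt`) and satisfies the slice rule
  `∂̄ (s ↦ u (x + s • v)) (t) = (∂̄_v u)(x + t • v)` (`dbarAlong_one_comp_lineMap`).
* `Literature.Analysis.Complex.integral_inv_smul_dbarAlong_sub` (**Cauchy–Pompeiu**): the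
  displayed formula.

## Proof

Hörmander proves (1.2.3) by Stokes' formula on `ω ∖ D(ζ, ε)`. We avoid boundary integrals: in
polar coordinates `t = r e^{iθ}` (Mathlib's `Complex.integral_comp_polarCoord_symm`) the integrand
`r · (π r e^{iθ})⁻¹ ∂̄φ(z - r e^{iθ})` equals `(2π)⁻¹ (Dφ(z - re^{iθ})[e^{iθ}] + i Dφ(z - re^{iθ})[i e^{iθ}])`
(`inv_smul_dbarAlong_one`); the first term is `-(2π)⁻¹ ∂ᵣ φ(z - re^{iθ})`, whose `r`-integral over
`(0, ∞)` is `(2π)⁻¹ φ(z)` for every `θ`, and the second is `-(2π r)⁻¹ i ∂_θ φ(z - re^{iθ})`, whose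
`θ`-integral over a period vanishes for every `r > 0` (Fubini on `(0, ∞) × (-π, π)`).

## References

* L. Hörmander, *An Introduction to Complex Analysis in Several Variables*, 2nd ed. (1973),
  §1.2, Thm. 1.2.1, formulas (1.2.1)–(1.2.3). [HormanderSCV1973]
-/

noncomputable section

open MeasureTheory Set Filter Function Complex
open scoped Real Topology

namespace Literature.Analysis.Complex

variable {E : Type*} [NormedAddCommGroup E] [NormedSpace ℂ E]
  {F : Type*} [NormedAddCommGroup F] [NormedSpace ℂ F]

/-! ### The directional Cauchy–Riemann operator -/

/-- The **Cauchy–Riemann operator in the direction `v`**: for `u : E → F` between complex normed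
spaces and `v ∈ E`, `dbarAlong v u x = ½ (Du(x)[v] + i • Du(x)[i • v])` with `D = fderiv ℝ`
(junk value `0` built into `fderiv` where `u` is not real-differentiable). For `E = ℂⁿ` and
`v = e_k` this is `∂u/∂z̄_k`; for `E = ℂ`, `v = 1` it is `∂u/∂z̄ = ½ (∂u/∂x + i ∂u/∂y)`
(Hörmander (1973), §1.1, the operator `∂/∂z̄`, and §2.1). [cite: HormanderSCV1973, §1.1] -/
def dbarAlong (v : E) (u : E → F) (x : E) : F :=
  (2 : ℂ)⁻¹ • (fderiv ℝ u x v + I • fderiv ℝ u x (I • v))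

/-- Unfolding of `dbarAlong`. [folklore] -/
theorem dbarAlong_apply (v : E) (u : E → F) (x : E) :
    dbarAlong v u x = (2 : ℂ)⁻¹ • (fderiv ℝ u x v + I • fderiv ℝ u x (I • v)) :=
  rfl

/-- In one variable, `dbarAlong 1` is the Wirtinger derivative `∂/∂z̄ = ½ (∂ₓ + i ∂_y)`.
[folklore] -/
theorem dbarAlong_one (φ : ℂ → F) (z : ℂ) :
    dbarAlong 1 φ z = (2 : ℂ)⁻¹ • (fderiv ℝ φ z 1 + I • fderiv ℝ φ z I) := by
  simp [dbarAlong]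

/-- `∂̄_v` kills complex-differentiable functions: if `u` is `ℂ`-differentiable at `x` then
`Du(x)[i v] = i Du(x)[v]`. [folklore] -/
theorem dbarAlong_eq_zero_of_differentiableAt {u : E → F} {x : E} (hu : DifferentiableAt ℂ u x)
    (v : E) : dbarAlong v u x = 0 := by
  rw [dbarAlong_apply, hu.fderiv_restrictScalars ℝ]
  simp [smul_smul]

/-- `∂̄_v` of the zero function vanishes. [folklore] -/
@[simp]
theorem dbarAlong_zero (v : E) (x : E) : dbarAlong v (0 : E → F) x = 0 := by
  simp [dbarAlong_apply]

/-- `∂̄_v` is additive in the function (at points of differentiability). [folklore] -/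
theorem dbarAlong_add {u w : E → F} {x : E} (hu : DifferentiableAt ℝ u x)
    (hw : DifferentiableAt ℝ w x) (v : E) :
    dbarAlong v (u + w) x = dbarAlong v u x + dbarAlong v w x := by
  simp only [dbarAlong_apply, fderiv_add hu hw, add_apply]
  module

/-- `∂̄_v` is additive in the function (lambda form). [folklore] -/
theorem dbarAlong_fun_add {u w : E → F} {x : E} (hu : DifferentiableAt ℝ u x)
    (hw : DifferentiableAt ℝ w x) (v : E) :
    dbarAlong v (fun y => u y + w y) x = dbarAlong v u x + dbarAlong v w x :=
  dbarAlong_add hu hw v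

/-- `∂̄_v` commutes with constant scalars. [folklore] -/
theorem dbarAlong_const_smul {u : E → F} {x : E} (hu : DifferentiableAt ℝ u x) (a : ℂ)
    (v : E) : dbarAlong v (a • u) x = a • dbarAlong v u x := by
  simp only [dbarAlong_apply, fderiv_const_smul hu a, smul_apply]
  module

/-- **Slice rule.** Along the complex line `s ↦ x + s • v`, the one-variable `∂/∂z̄` of the slice
of `u` is the slice of `∂̄_v u`: `∂̄ (s ↦ u (x + s • v)) (t) = (∂̄_v u)(x + t • v)`. [folklore] -/
theorem dbarAlong_one_comp_lineMap {u : E → F} (x v : E) {t : ℂ}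
    (hu : DifferentiableAt ℝ u (x + t • v)) :
    dbarAlong 1 (fun s : ℂ => u (x + s • v)) t = dbarAlong v u (x + t • v) := by
  have hl : HasFDerivAt (fun s : ℂ => x + s • v)
      ((ContinuousLinearMap.id ℝ ℂ).smulRight v) t := by
    simpa using ((hasFDerivAt_id (𝕜 := ℝ) t).smul_const v).const_add x
  have hcomp : HasFDerivAt (fun s : ℂ => u (x + s • v))
      ((fderiv ℝ u (x + t • v)).comp ((ContinuousLinearMap.id ℝ ℂ).smulRight v)) t :=
    hu.hasFDerivAt.comp t hl
  rw [dbarAlong_apply, dbarAlong_apply, hcomp.fderiv]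
  simp

/-! ### Calculus along rays and circles -/

/-- For `a² + b² = 1`, `(a + bi)(a - bi) = 1`. [folklore] -/
theorem ofReal_add_mul_I_mul_sub {a b : ℝ} (h : a ^ 2 + b ^ 2 = 1) :
    ((a : ℂ) + b * I) * (a - b * I) = 1 := by
  have h1 : (a : ℂ) ^ 2 + (b : ℂ) ^ 2 = 1 := by exact_mod_cast h
  linear_combination h1 - (b : ℂ) ^ 2 * I_mul_I

/-- A unit vector `a + bi` (`a² + b² = 1`) is nonzero. [folklore] -/
theorem ofReal_add_mul_I_ne_zero {a b : ℝ} (h : a ^ 2 + b ^ 2 = 1) :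
    ((a : ℂ) + b * I) ≠ 0 := fun h0 => by
  have := ofReal_add_mul_I_mul_sub h
  rw [h0, zero_mul] at this
  exact zero_ne_one this

/-- The pointwise identity behind the polar-coordinate proof of Cauchy–Pompeiu: for a unit
vector `c = a + bi`, `c⁻¹ • ∂̄φ(w) = ½ (Dφ(w)[c] + i • Dφ(w)[i c])`. [folklore] -/
theorem inv_smul_dbarAlong_one (φ : ℂ → F) (w : ℂ) {a b : ℝ} (h : a ^ 2 + b ^ 2 = 1) :
    ((a : ℂ) + b * I)⁻¹ • dbarAlong 1 φ w =
      (2 : ℂ)⁻¹ • (fderiv ℝ φ w (a + b * I) + I • fderiv ℝ φ w (I * (a + b * I))) := by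
  rw [inv_eq_of_mul_eq_one_right (ofReal_add_mul_I_mul_sub h), dbarAlong_one]
  have ec : ((a : ℂ) + b * I : ℂ) = a • (1 : ℂ) + b • I := by
    simp [real_smul]
  have eIc : I * ((a : ℂ) + b * I) = (-b) • (1 : ℂ) + a • I := by
    simp only [real_smul, ofReal_neg]
    linear_combination (b : ℂ) * I_mul_I
  rw [eIc, ec, map_add, map_add, map_smul, map_smul, map_smul, map_smul]
  simp only [← coe_smul]
  match_scalars
  · ring
  · linear_combination (-(2 : ℂ)⁻¹ * (b : ℂ)) * I_mul_I

/-- Radial chain rule: `d/dr φ(z - r c) = -Dφ(z - r c)[c]`. [folklore] -/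
theorem hasDerivAt_comp_sub_ofReal_mul {φ : ℂ → F} (z c : ℂ) (r : ℝ)
    (hφ : DifferentiableAt ℝ φ (z - r * c)) :
    HasDerivAt (fun s : ℝ => φ (z - s * c)) (-(fderiv ℝ φ (z - r * c) c)) r := by
  have h1 : HasDerivAt (fun s : ℝ => z - (s : ℂ) * c) (-c) r := by
    simpa using ((hasDerivAt_id r).ofReal_comp.mul_const c).const_sub z
  have h2 : HasDerivAt (fun s : ℝ => φ (z - s * c)) (fderiv ℝ φ (z - r * c) (-c)) r :=
    hφ.hasFDerivAt.comp_hasDerivAt r h1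
  simpa using h2

/-- Angular chain rule: `d/dθ φ(z - r e^{iθ}) = -r • Dφ(z - r e^{iθ})[i e^{iθ}]`, with
`e^{iθ} = cos θ + i sin θ` as in `Complex.polarCoord`. [folklore] -/
theorem hasDerivAt_comp_sub_mul_cos_add_sin {φ : ℂ → F} (z : ℂ) (r θ : ℝ)
    (hφ : DifferentiableAt ℝ φ (z - r * (Real.cos θ + Real.sin θ * I))) :
    HasDerivAt (fun t : ℝ => φ (z - r * (Real.cos t + Real.sin t * I)))
      (-(r • fderiv ℝ φ (z - r * (Real.cos θ + Real.sin θ * I))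
        (I * (Real.cos θ + Real.sin θ * I)))) θ := by
  have hcos : HasDerivAt (fun t : ℝ => (Real.cos t : ℂ)) (-Real.sin θ) θ := by
    have := (Real.hasDerivAt_cos θ).ofReal_comp
    rwa [ofReal_neg] at this
  have hsin : HasDerivAt (fun t : ℝ => (Real.sin t : ℂ) * I) (Real.cos θ * I) θ :=
    (Real.hasDerivAt_sin θ).ofReal_comp.mul_const I
  have hc : HasDerivAt (fun t : ℝ => (Real.cos t : ℂ) + Real.sin t * I)
      (I * (Real.cos θ + Real.sin θ * I)) θ :=
    (hcos.add hsin).congr_deriv (by linear_combination (-(Real.sin θ : ℂ)) * I_mul_I)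
  have h1 : HasDerivAt (fun t : ℝ => z - (r : ℂ) * (Real.cos t + Real.sin t * I))
      (-((r : ℂ) * (I * (Real.cos θ + Real.sin θ * I)))) θ :=
    (hc.const_mul (r : ℂ)).const_sub z
  have h2 : HasDerivAt (fun t : ℝ => φ (z - r * (Real.cos t + Real.sin t * I)))
      (fderiv ℝ φ (z - r * (Real.cos θ + Real.sin θ * I))
        (-((r : ℂ) * (I * (Real.cos θ + Real.sin θ * I))))) θ :=
    hφ.hasFDerivAt.comp_hasDerivAt θ h1
  refine h2.congr_deriv ?_
  rw [map_neg, ← map_smul, real_smul]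

omit [NormedSpace ℂ F] in
/-- A continuous function on `ℝ × ℝ` vanishing for large first coordinate is integrable on the
polar-coordinate target `(0, ∞) × (-π, π)`. [folklore] -/
theorem integrableOn_polar_target_of_eq_zero {G : ℝ × ℝ → F} (hG : Continuous G) {R₁ : ℝ}
    (h0 : ∀ p : ℝ × ℝ, R₁ < p.1 → G p = 0) :
    IntegrableOn G (Ioi (0 : ℝ) ×ˢ Ioo (-π) π) := by
  have h1 : IntegrableOn G (Icc 0 (max R₁ 0) ×ˢ Icc (-π) π) :=
    hG.continuousOn.integrableOn_compact (isCompact_Icc.prod isCompact_Icc)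
  have h2 : IntegrableOn G (Ioi (max R₁ 0) ×ˢ (univ : Set ℝ)) :=
    integrableOn_zero.congr_fun (fun p hp => (h0 p ((le_max_left _ _).trans_lt hp.1)).symm)
      (measurableSet_Ioi.prod MeasurableSet.univ)
  refine (h1.union h2).mono_set ?_
  rintro ⟨r, t⟩ ⟨hr, ht⟩
  by_cases h : r ≤ max R₁ 0
  · exact Or.inl ⟨⟨le_of_lt hr, h⟩, Ioo_subset_Icc_self ht⟩
  · exact Or.inr ⟨not_le.mp h, mem_univ _⟩

/-! ### The Cauchy–Pompeiu formula -/

section CauchyPompeiu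

variable [CompleteSpace F]

/-- **Cauchy–Pompeiu formula** (generalized Cauchy integral formula for compactly supported
`C¹` functions, Hörmander (1973), Thm. 1.2.1, (1.2.3), with `ω ⊃ supp φ` so that
`∫_{∂ω} = 0`): for `φ ∈ C¹_c(ℂ, F)` and `z ∈ ℂ`,
`∫_ℂ (π t)⁻¹ • (∂φ/∂z̄)(z - t) dA(t) = φ(z)`. [cite: HormanderSCV1973, Thm. 1.2.1] -/
theorem integral_inv_smul_dbarAlong_sub {φ : ℂ → F} (hφ : ContDiff ℝ 1 φ)
    (hsupp : HasCompactSupport φ) (z : ℂ) :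
    ∫ t : ℂ, (↑π * t)⁻¹ • dbarAlong 1 φ (z - t) = φ z := by
  -- support control
  obtain ⟨R, hR⟩ := hsupp.isCompact.isBounded.subset_closedBall 0
  have hD0 : ∀ w : ℂ, R < ‖w‖ → fderiv ℝ φ w = 0 := fun w hw =>
    fderiv_of_notMem_tsupport ℝ fun h => by
      have := hR h
      rw [Metric.mem_closedBall, dist_zero_right] at this
      exact absurd this (not_le.mpr hw)
  have hφ0 : ∀ w : ℂ, R < ‖w‖ → φ w = 0 := fun w hw =>
    image_eq_zero_of_notMem_tsupport fun h => by
      have := hR h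
      rw [Metric.mem_closedBall, dist_zero_right] at this
      exact absurd this (not_le.mpr hw)
  have hdiff : ∀ w, DifferentiableAt ℝ φ w := fun w => (hφ.differentiable one_ne_zero) w
  have hcontD : Continuous (fderiv ℝ φ) := hφ.continuous_fderiv one_ne_zero
  -- the unit vectors `e^{iθ}`
  set c : ℝ → ℂ := fun t => (Real.cos t : ℂ) + Real.sin t * I with hc_def
  have hc1 : ∀ t, ‖c t‖ = 1 := fun t => by
    rw [show c t = Complex.exp (t * I) by
      rw [Complex.exp_mul_I, ← ofReal_cos, ← ofReal_sin]]
    exact norm_exp_ofReal_mul_I t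
  have hcc : Continuous c := by simp only [hc_def]; fun_prop
  have hfar : ∀ r t : ℝ, R + ‖z‖ < |r| → R < ‖z - r * c t‖ := fun r t hr => by
    have hn : ‖(r : ℂ) * c t‖ = |r| := by
      rw [norm_mul, norm_real, hc1, mul_one, Real.norm_eq_abs]
    have h1 : ‖(r : ℂ) * c t‖ - ‖z‖ ≤ ‖z - r * c t‖ := by
      rw [← norm_neg (z - r * c t), neg_sub]; exact norm_sub_norm_le _ _
    linarith
  -- the two integrands after passing to polar coordinates
  set fA : ℝ × ℝ → F := fun p => fderiv ℝ φ (z - p.1 * c p.2) (c p.2) with hfA_def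
  set fB : ℝ × ℝ → F := fun p => fderiv ℝ φ (z - p.1 * c p.2) (I * c p.2) with hfB_def
  have hargc : Continuous fun p : ℝ × ℝ => z - (p.1 : ℂ) * c p.2 := by fun_prop
  have hfA_cont : Continuous fA := (hcontD.comp hargc).clm_apply (hcc.comp continuous_snd)
  have hfB_cont : Continuous fB :=
    (hcontD.comp hargc).clm_apply (continuous_const.mul (hcc.comp continuous_snd))
  have hfA0 : ∀ p : ℝ × ℝ, R + ‖z‖ < |p.1| → fA p = 0 := fun p hp => by
    simp [hfA_def, hD0 _ (hfar p.1 p.2 hp)]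
  have hfB0 : ∀ p : ℝ × ℝ, R + ‖z‖ < |p.1| → fB p = 0 := fun p hp => by
    simp [hfB_def, hD0 _ (hfar p.1 p.2 hp)]
  have hfA_int : IntegrableOn fA (Ioi (0 : ℝ) ×ˢ Ioo (-π) π) :=
    integrableOn_polar_target_of_eq_zero hfA_cont (R₁ := R + ‖z‖) fun p hp =>
      hfA0 p (hp.trans_le (le_abs_self _))
  have hfB_int : IntegrableOn fB (Ioi (0 : ℝ) ×ˢ Ioo (-π) π) :=
    integrableOn_polar_target_of_eq_zero hfB_cont (R₁ := R + ‖z‖) fun p hp =>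
      hfB0 p (hp.trans_le (le_abs_self _))
  -- (A) the radial integrals: `∫₀^∞ Dφ(z - r c)[c] dr = φ z` for every direction `c`
  have hA1 : ∀ t : ℝ, ∫ r in Ioi (0 : ℝ), fA (r, t) = φ z := fun t => by
    have hderiv : ∀ r ∈ Ioi (0 : ℝ),
        HasDerivAt (fun s : ℝ => -φ (z - s * c t)) (fA (r, t)) r := fun r _ => by
      have h : HasDerivAt (fun s : ℝ => -φ (z - s * c t))
          (-(-(fderiv ℝ φ (z - r * c t) (c t)))) r :=
        (hasDerivAt_comp_sub_ofReal_mul z (c t) r (hdiff _)).neg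
      simpa [hfA_def] using h
    have hcont : ContinuousWithinAt (fun s : ℝ => -φ (z - s * c t)) (Ici 0) 0 :=
      ((hφ.continuous.comp (by fun_prop)).neg).continuousWithinAt
    have hint : IntegrableOn (fun r => fA (r, t)) (Ioi (0 : ℝ)) := by
      refine (Continuous.integrable_of_hasCompactSupport (hfA_cont.comp (by fun_prop))
        ?_).integrableOn
      refine HasCompactSupport.intro (K := Icc (-(R + ‖z‖)) (R + ‖z‖)) isCompact_Icc ?_
      intro r hr
      rw [mem_Icc, not_and_or, not_le, not_le] at hr
      refine hfA0 (r, t) (lt_abs.mpr ?_)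
      rcases hr with hr | hr
      · exact Or.inr (by linarith)
      · exact Or.inl hr
    have hlim : Tendsto (fun s : ℝ => -φ (z - s * c t)) atTop (𝓝 0) := by
      refine tendsto_const_nhds.congr' ?_
      filter_upwards [eventually_gt_atTop (R + ‖z‖)] with s hs
      rw [hφ0 _ (hfar s t (hs.trans_le (le_abs_self s))), neg_zero]
    have := integral_Ioi_of_hasDerivAt_of_tendsto hcont hderiv hint hlim
    simpa using this
  -- (B) the angular integrals vanish: `∫_{-π}^{π} Dφ(z - r e^{iθ})[i e^{iθ}] dθ = 0`, `r > 0`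
  have hB1 : ∀ r : ℝ, 0 < r → ∫ t in Ioo (-π) π, fB (r, t) = 0 := fun r hr => by
    have hderiv : ∀ t : ℝ,
        HasDerivAt (fun s : ℝ => -(r⁻¹ • φ (z - r * c s))) (fB (r, t)) t := fun t => by
      have h : HasDerivAt (fun s : ℝ => -(r⁻¹ • φ (z - r * c s)))
          (-(r⁻¹ • -(r • fderiv ℝ φ (z - r * (Real.cos t + Real.sin t * I))
            (I * (Real.cos t + Real.sin t * I))))) t :=
        ((hasDerivAt_comp_sub_mul_cos_add_sin z r t (hdiff _)).const_smul r⁻¹).neg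
      refine h.congr_deriv ?_
      simp only [hfB_def, hc_def]
      rw [smul_neg, neg_neg, smul_smul, inv_mul_cancel₀ hr.ne', one_smul]
    rw [← integral_Ioc_eq_integral_Ioo,
      ← intervalIntegral.integral_of_le (by linarith [Real.pi_pos]),
      intervalIntegral.integral_eq_sub_of_hasDerivAt (fun t _ => hderiv t)
        ((hfB_cont.comp (by fun_prop)).intervalIntegrable _ _)]
    simp [hc_def]
  -- pass to polar coordinates
  rw [← Complex.integral_comp_polarCoord_symm]
  change ∫ p in Ioi (0 : ℝ) ×ˢ Ioo (-π) π, _ = _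
  have step2 : EqOn
      (fun p : ℝ × ℝ => p.1 • ((↑π * Complex.polarCoord.symm p)⁻¹ •
        dbarAlong 1 φ (z - Complex.polarCoord.symm p)))
      (fun p => (π : ℂ)⁻¹ • ((2 : ℂ)⁻¹ • (fA p + I • fB p))) (Ioi (0 : ℝ) ×ˢ Ioo (-π) π) := by
    rintro ⟨r, t⟩ ⟨hr, -⟩
    simp only [Complex.polarCoord_symm_apply, hfA_def, hfB_def, hc_def]
    rw [← coe_smul, smul_smul, ← inv_smul_dbarAlong_one φ _ (Real.cos_sq_add_sin_sq t),
      smul_smul]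
    congr 1
    have hc0 := ofReal_add_mul_I_ne_zero (Real.cos_sq_add_sin_sq t)
    have hr0 : (r : ℂ) ≠ 0 := ofReal_ne_zero.mpr (ne_of_gt hr)
    have hπ : (π : ℂ) ≠ 0 := ofReal_ne_zero.mpr Real.pi_pos.ne'
    field_simp
  have hIB : IntegrableOn (fun p => I • fB p) (Ioi (0 : ℝ) ×ˢ Ioo (-π) π) := hfB_int.smul I
  rw [setIntegral_congr_fun (measurableSet_Ioi.prod measurableSet_Ioo) step2, integral_smul,
    integral_smul, integral_add hfA_int hIB, integral_smul]
  -- (A) and (B) via Fubini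
  have hA : ∫ p in Ioi (0 : ℝ) ×ˢ Ioo (-π) π, fA p = (2 * π) • φ z := by
    rw [Measure.volume_eq_prod, ← setIntegral_prod_swap, setIntegral_prod _ ?_]
    · simp only [Prod.swap_prod_mk, hA1]
      rw [setIntegral_const, measureReal_def, Real.volume_Ioo,
        ENNReal.toReal_ofReal (by linarith [Real.pi_pos])]
      ring_nf
    · have h1 := hfA_int
      rw [IntegrableOn, Measure.volume_eq_prod, ← Measure.prod_restrict] at h1
      rw [IntegrableOn, ← Measure.prod_restrict]
      exact h1.swap
  have hB : ∫ p in Ioi (0 : ℝ) ×ˢ Ioo (-π) π, fB p = 0 := by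
    have h1 := hfB_int
    rw [IntegrableOn, Measure.volume_eq_prod] at h1
    rw [Measure.volume_eq_prod, setIntegral_prod _ h1]
    refine (setIntegral_congr_fun measurableSet_Ioi (g := fun _ => (0 : F))
      fun r hr => ?_).trans (by simp)
    exact hB1 r hr
  rw [hA, hB, smul_zero, add_zero, ← coe_smul, smul_smul, smul_smul]
  have hπ : (π : ℂ) ≠ 0 := ofReal_ne_zero.mpr Real.pi_pos.ne'
  rw [show (π : ℂ)⁻¹ * (2 : ℂ)⁻¹ * ((2 * π : ℝ) : ℂ) = 1 by push_cast; field_simp, one_smul]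

end CauchyPompeiu

end Literature.Analysis.Complex
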